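import Literature.AnabelianGeometry.AbsoluteAnabelian.AbsAnabLevelFieldsProofs
import Literature.NumberTheory.GaloisRepresentations.LocalReciprocityNormFunctoriality
import Literature.AlgebraicGeometry.Frobenioids.PadicKummerLocalFieldIso
import HarnessLib

/-!
# A Galois level `L/F` above `E₀` and its copy `ι(L) ⊆ Ē`: the field isomorphism `L ≅ ι(L)`, its
# extension to algebraic closures, and the induced map on `Gal(F̄/L) → Γ_{ι(L)}`

abc-iut cell, layer L4, row «COR110ib-OPEN» file F1 (abc-iut-L4-t11): bookkeeping for the
restriction-compatibility of the canonical cyclotome identifications ([AbsAnab] Prop. 1.2.1 (vi)/(vii)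
«by considering the Verlagerung»; [AbsTopIII] Cor. 1.10 (i), Rmk. 1.10.1 (iii)).  For a finite extension
`E/F` of fields, with `E₀ = ι⁻¹(E) ⊆ F̄` (`embField F E`, `ι = absClosureEmbedding F E : F̄ ≅ Ē`), and a
finite GALOIS level `L ⊆ F̄` of `F` containing `E₀`, let `M′ := ι(L) ⊆ Ē`
(`LocalWeilDatum.extField F E L`).  Proof-only (∃-packaged data, no definitions):

* `normal_extField` — `M′/E` is normal (Galois), so `embField E M′ = M′`;
* `liftGal_mem_galFixing_extField` — `liftGal F E` carries `Gal(F̄/L)` into `Gal(Ē/M′)`;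
* `exists_levelFieldIso` — there are a ring isomorphism `σ : L ≅ M′` and an extension
  `σ̄ : L̄ ≅ M̄′` to the algebraic closures (`σ̄ ∘ algebraMap = algebraMap ∘ σ`) such that
  (a) `σ` is "`ι` read through the tree's identifications `L ≃ embField F L`, `M′ ≃ embField E M′`"
  (`equivEmbField`), (b) conjugation by `σ̄` (`PadicKummer.galConj σ σ̄`) sends the lift
  `liftGal F L h ∈ Γ_L` of `h ∈ Gal(F̄/L)` to the lift `liftGal E M′ (liftGal F E h) ∈ Γ_{M′}` ON THE
  NOSE, and (c) `σ` matches integrality over `𝒪_F` with integrality over `𝒪_E` (for local `F ⊆ E`).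
These feed abc-iut-L4-d3's `canonicalTheta_unitsTransport` (naturality of Serre's `θ` under the field
isomorphism `σ`) in the sequel.  Universe `0` (the tree's `galConj`).  HONEST FRAMING: Galois
bookkeeping; nothing here bears on [IUTchIII] Cor. 3.12.
-/

noncomputable section

open Field IntermediateField ValuativeRel
open scoped Pointwise

namespace Literature.AnabelianGeometry.AbsoluteAnabelian

open Literature.NumberTheory.GaloisRepresentations
open Literature.NumberTheory.GaloisRepresentations.LocalWeilDatum
open Literature.AlgebraicGeometry.Frobenioids.PadicKummer

namespace Cor110Open

section Level

variable (F E : Type) [Field F] [Field E] [Algebra F E] [FiniteDimensional F E]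
  (L : IntermediateField F (AlgebraicClosure F))

/-! ### `M′ = ι(L)` is Galois over `E` -/

/-- **`ι(L)/E` is Galois** for `L/F` Galois containing `E₀`: `L/E₀` is Galois (top of the tower
`F ⊆ E₀ ⊆ L`) and `(E₀ ⊆ L) ≅ (E ⊆ ι(L))` along `ι`. [cite: MochizukiAbsAnab2004, Prop 1.2.1 (vii) p.11] -/
theorem isGalois_extField' [IsGalois F L] (hEL : embField F E ≤ L) : IsGalois E (extField F E L hEL) := by
  letI : Algebra (embField F E) L := (IntermediateField.inclusion hEL).toAlgebra
  haveI : IsScalarTower F (embField F E) L := IsScalarTower.of_algebraMap_eq fun _ => rfl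
  haveI : IsGalois (embField F E) L := IsGalois.tower_top_of_isGalois F (embField F E) L
  let f : embField F E ≃+* E := (equivEmbField F E).symm.toRingEquiv
  let g : L ≃+* extField F E L hEL := (equivExtField F E L hEL).toRingEquiv
  refine IsGalois.of_equiv_equiv (F := embField F E) (E := L) (f := f) (g := g) ?_
  ext k
  change algebraMap E (AlgebraicClosure E) ((equivEmbField F E).symm k) =
    absClosureEmbedding F E (k : AlgebraicClosure F)
  exact (absClosureEmbedding_coe_eq F E k).symm

/-- `ι(L)/E` is normal. [cite: MochizukiAbsAnab2004, Prop 1.2.1 (vii) p.11] -/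
theorem normal_extField [IsGalois F L] (hEL : embField F E ≤ L) : Normal E (extField F E L hEL) :=
  (isGalois_extField' F E L hEL).to_normal

/-- `embField E ι(L) = ι(L)` (normal levels are their own copies). [cite: MochizukiAbsAnab2004, Prop 1.2.1 (vii) p.11] -/
theorem embField_extField_eq [IsGalois F L] (hEL : embField F E ≤ L) :
    embField E (extField F E L hEL) = extField F E L hEL := by
  haveI := normal_extField F E L hEL
  exact embField_coe_eq_self (extField F E L hEL)

/-! ### `liftGal F E : Gal(F̄/L) → Gal(Ē/ι(L))` -/

omit [FiniteDimensional F E] in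
/-- `Gal(F̄/L) ≤ Gal(F̄/E₀)` since `E₀ ≤ L`. [cite: MochizukiAbsAnab2004, Prop 1.2.1 (vii) p.11] -/
theorem galFixing_level_le (hEL : embField F E ≤ L) : galFixing F L ≤ galFixing F (embField F E) :=
  galFixing_antitone F hEL

/-- **`liftGal F E h ∈ Gal(Ē/ι(L))` for `h ∈ Gal(F̄/L)`**: `liftGal h • ι a = ι (h • a) = ι a` for `a ∈ L`.
[cite: MochizukiAbsAnab2004, Prop 1.2.1 (vii) p.11] -/
theorem liftGal_mem_galFixing_extField (hEL : embField F E ≤ L) {h : absoluteGaloisGroup F}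
    (hhL : h ∈ galFixing F L) :
    liftGal F E (galFixing_level_le F E L hEL hhL) ∈ galFixing E (extField F E L hEL) := by
  rw [mem_galFixing_iff]
  intro y hy
  rw [mem_extField_iff] at hy
  have hy' : y = absClosureEmbedding F E ((absClosureEquiv F E).symm y) :=
    (absClosureEmbedding_absClosureEquiv_symm F E y).symm
  have hfix : h • (absClosureEquiv F E).symm y = (absClosureEquiv F E).symm y :=
    ((mem_galFixing_iff (F := F)).mp hhL) _ hy
  rw [hy', liftGal_smul, hfix]

/-- The same membership, for the copy `embField E ι(L)`. [cite: MochizukiAbsAnab2004, Prop 1.2.1 (vii) p.11] -/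
theorem liftGal_mem_galFixing_embField_extField [IsGalois F L] (hEL : embField F E ≤ L)
    {h : absoluteGaloisGroup F} (hhL : h ∈ galFixing F L) :
    liftGal F E (galFixing_level_le F E L hEL hhL) ∈ galFixing E (embField E (extField F E L hEL)) := by
  rw [embField_extField_eq]
  exact liftGal_mem_galFixing_extField F E L hEL hhL

/-! ### The field isomorphism `σ : L ≅ ι(L)` and its extension `σ̄ : L̄ ≅ ι(L)‾` -/

/-- **The level isomorphism and its lift.**  With `M′ = ι(L)`, `e_L : L ≃ embField F L` and
`e′ : M′ ≃ embField E M′` the tree's identifications (`equivEmbField`), `λ_L : F̄ ≅ L̄`, `ι : F̄ ≅ Ē`,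
`λ′ : Ē ≅ M̄′` the chosen identifications of algebraic closures (`absClosureEquiv`): there are
`σ : L ≃+* M′` and `σ̄ : L̄ ≃+* M̄′` (namely `σ = e′⁻¹ ∘ ι ∘ e_L` and `σ̄ = λ′ ∘ ι ∘ λ_L⁻¹`) with
(0) `σ̄` extends `σ`; (a) `ι (e_L w) = e′ (σ w)` in `Ē`; (b) for `h ∈ Gal(F̄/L)`, conjugation by `σ̄`
sends `liftGal F L h` to `liftGal E M′ (liftGal F E h)` (both are `h` transported along isomorphisms of
algebraic closures which agree: `λ′ ∘ ι = σ̄ ∘ λ_L`); (c) for non-archimedean local `F ⊆ E` (valuation of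
`E` extending that of `F`), `w ∈ L` is integral over `𝒪_F` iff `σ w ∈ M′` is integral over `𝒪_E`
(`absClosureEmbedding_mem_absIntegers_iff`). [cite: MochizukiAbsAnab2004, Prop 1.2.1 (vii) p.11] -/
theorem exists_levelFieldIso [IsGalois F L] (hEL : embField F E ≤ L) :
    ∃ (σ : L ≃+* extField F E L hEL)
      (σl : AlgebraicClosure L ≃+* AlgebraicClosure (extField F E L hEL))
      (hσ : ∀ w : L, σl (algebraMap L (AlgebraicClosure L) w) =
        algebraMap (extField F E L hEL) (AlgebraicClosure (extField F E L hEL)) (σ w)),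
      (∀ w : L, ((equivEmbField E (extField F E L hEL) (σ w) : embField E (extField F E L hEL)) :
          AlgebraicClosure E) =
        absClosureEmbedding F E ((equivEmbField F L w : embField F L) : AlgebraicClosure F)) ∧
      (∀ (h : absoluteGaloisGroup F) (hhL : h ∈ galFixing F L) (hhL' : h ∈ galFixing F (embField F L)),
        galConj σ σl hσ (liftGal F L hhL') =
          liftGal E (extField F E L hEL) (liftGal_mem_galFixing_embField_extField F E L hEL hhL)) ∧
      (∀ σ' : absoluteGaloisGroup L, ∀ y : AlgebraicClosure L,
        σl (σ' • y) = galConj σ σl hσ σ' • σl y) := by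
  classical
  haveI := normal_extField F E L hEL
  let M' := extField F E L hEL
  -- the chosen identifications of algebraic closures
  let lamL : AlgebraicClosure F ≃ₐ[F] AlgebraicClosure L := absClosureEquiv F L
  let iota : AlgebraicClosure F ≃ₐ[F] AlgebraicClosure E := absClosureEquiv F E
  let lam' : AlgebraicClosure E ≃ₐ[E] AlgebraicClosure M' := absClosureEquiv E M'
  let σl : AlgebraicClosure L ≃+* AlgebraicClosure M' :=
    (lamL.symm.toRingEquiv.trans iota.toRingEquiv).trans lam'.toRingEquiv
  have hσl : ∀ z, σl z = lam' (iota (lamL.symm z)) := fun _ => rfl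
  -- `ι` restricted to the copies `embField F L = L → embField E M′ = M′`
  have hLL : embField F L = L := embField_coe_eq_self L
  have hMM : embField E M' = M' := embField_coe_eq_self M'
  have hmem : ∀ a : embField F L, absClosureEmbedding F E (a : AlgebraicClosure F) ∈ embField E M' :=
    fun a => hMM.symm.le ((absClosureEmbedding_mem_extField_iff F E hEL).mpr (hLL.le a.2))
  have hmem' : ∀ b : embField E M', (absClosureEquiv F E).symm (b : AlgebraicClosure E) ∈ embField F L :=
    fun b => hLL.symm.le ((mem_extField_iff (F := F) (E := E) hEL).mp (hMM.le b.2))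
  let ιLM : embField F L ≃+* embField E M' :=
    { toFun := fun a => ⟨absClosureEmbedding F E (a : AlgebraicClosure F), hmem a⟩
      invFun := fun b => ⟨(absClosureEquiv F E).symm (b : AlgebraicClosure E), hmem' b⟩
      left_inv := fun a => Subtype.ext (absClosureEquiv_symm_absClosureEmbedding F E _)
      right_inv := fun b => Subtype.ext (absClosureEmbedding_absClosureEquiv_symm F E _)
      map_mul' := fun a b => Subtype.ext (by simp)
      map_add' := fun a b => Subtype.ext (by simp) }
  have hιLM : ∀ a : embField F L, ((ιLM a : embField E M') : AlgebraicClosure E) =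
      absClosureEmbedding F E (a : AlgebraicClosure F) := fun _ => rfl
  let σ : L ≃+* M' :=
    ((equivEmbField F L).toRingEquiv.trans ιLM).trans (equivEmbField E M').symm.toRingEquiv
  have hσdef : ∀ w : L, σ w = (equivEmbField E M').symm (ιLM (equivEmbField F L w)) := fun _ => rfl
  -- (a)
  have ha : ∀ w : L, ((equivEmbField E M' (σ w) : embField E M') : AlgebraicClosure E) =
      absClosureEmbedding F E ((equivEmbField F L w : embField F L) : AlgebraicClosure F) := by
    intro w
    rw [hσdef, AlgEquiv.apply_symm_apply, hιLM]
  -- (0): `σ̄` extends `σ`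
  have h0 : ∀ w : L, σl (algebraMap L (AlgebraicClosure L) w) = algebraMap M' (AlgebraicClosure M') (σ w) := by
    intro w
    rw [hσl]
    have h1 : lamL.symm (algebraMap L (AlgebraicClosure L) w) =
        ((equivEmbField F L w : embField F L) : AlgebraicClosure F) := by
      apply lamL.injective
      rw [AlgEquiv.apply_symm_apply]
      exact (absClosureEmbedding_equivEmbField F L w).symm
    rw [h1]
    change lam' (absClosureEmbedding F E _) = _
    rw [← ha w]
    have h2 := absClosureEmbedding_coe_eq E M' (equivEmbField E M' (σ w))
    rw [AlgEquiv.symm_apply_apply] at h2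
    exact h2
  refine ⟨σ, σl, h0, ha, fun h hhL hhL' => ?_, fun σ' y => ?_⟩
  · -- (b): both sides act on `M̄′ = λ′ ι F̄` by `λ′ ι (h • ·)`
    apply (absoluteGaloisGroup.toAlgEquiv M').injective
    refine AlgEquiv.ext fun y => ?_
    change galConj σ σl h0 (liftGal F L hhL') • y =
      liftGal E M' (liftGal_mem_galFixing_embField_extField F E L hEL hhL) • y
    obtain ⟨b, rfl⟩ : ∃ b : AlgebraicClosure F, y = lam' (iota b) :=
      ⟨iota.symm (lam'.symm y), by rw [AlgEquiv.apply_symm_apply, AlgEquiv.apply_symm_apply]⟩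
    rw [galConj_smul]
    have hs : σl.symm (lam' (iota b)) = lamL b := by
      apply σl.injective
      rw [RingEquiv.apply_symm_apply, hσl, AlgEquiv.symm_apply_apply]
    rw [hs]
    change σl (liftGal F L hhL' • absClosureEmbedding F L b) =
      liftGal E M' (liftGal_mem_galFixing_embField_extField F E L hEL hhL) •
        absClosureEmbedding E M' (absClosureEmbedding F E b)
    rw [liftGal_smul, liftGal_smul, liftGal_smul, hσl]
    change lam' (iota (lamL.symm (lamL (h • b)))) = _
    rw [AlgEquiv.symm_apply_apply]
    rfl
  · -- conjugation formula
    rw [galConj_smul, RingEquiv.symm_apply_apply]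

end Level

/-! ### Integrality along `σ` -/

section Integral

variable (F E : Type) [Field F] [ValuativeRel F] [TopologicalSpace F] [IsNonarchimedeanLocalField F]
  [Field E] [ValuativeRel E] [TopologicalSpace E] [IsNonarchimedeanLocalField E]
  [Algebra F E] [FiniteDimensional F E] [ValuativeExtension F E]
  (L : IntermediateField F (AlgebraicClosure F))

omit [TopologicalSpace F] [IsNonarchimedeanLocalField F] in
/-- Integrality over `𝒪_F` is invariant under the twist `w ↦ e_L w` of the level (`e_L = equivEmbField F L`
is `λ_L⁻¹ ∘ algebraMap`, an `F`-algebra map into `F̄`). [cite: SerreLocalFields1979, Ch. II §2 Prop. 3] -/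
theorem mem_absIntegers_equivEmbField_iff [FiniteDimensional F L] (w : L) :
    ((equivEmbField F L w : embField F L) : AlgebraicClosure F) ∈ absIntegers 𝒪[F] F ↔
      (w : AlgebraicClosure F) ∈ absIntegers 𝒪[F] F := by
  -- `e_L w = λ_L⁻¹ (algebraMap L L̄ w)` and `λ_L`, `algebraMap L L̄ ∘ (L ⊆ F̄)⁻¹` are `𝒪_F`-algebra maps
  have h1 : ((equivEmbField F L w : embField F L) : AlgebraicClosure F) =
      (absClosureEquiv F L).symm (algebraMap L (AlgebraicClosure L) w) := by
    apply (absClosureEquiv F L).injective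
    rw [AlgEquiv.apply_symm_apply]
    exact absClosureEmbedding_equivEmbField F L w
  rw [h1, mem_integralClosure_iff, mem_integralClosure_iff]
  have e₁ : IsIntegral 𝒪[F] ((absClosureEquiv F L).symm (algebraMap L (AlgebraicClosure L) w)) ↔
      IsIntegral 𝒪[F] (algebraMap L (AlgebraicClosure L) w) := by
    constructor
    · intro h
      have := h.map (((absClosureEquiv F L) : AlgebraicClosure F →ₐ[F] AlgebraicClosure L).restrictScalars 𝒪[F])
      simpa using this
    · intro h
      have := h.map (((absClosureEquiv F L).symm : AlgebraicClosure L →ₐ[F] AlgebraicClosure F).restrictScalars 𝒪[F])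
      simpa using this
  rw [e₁]
  have e₂ : IsIntegral 𝒪[F] (algebraMap L (AlgebraicClosure L) w) ↔ IsIntegral 𝒪[F] w :=
    isIntegral_algHom_iff ((IsScalarTower.toAlgHom F L (AlgebraicClosure L)).restrictScalars 𝒪[F])
      (algebraMap L (AlgebraicClosure L)).injective
  have e₃ : IsIntegral 𝒪[F] ((L.val.restrictScalars 𝒪[F]) w) ↔ IsIntegral 𝒪[F] w :=
    isIntegral_algHom_iff (L.val.restrictScalars 𝒪[F]) (fun _ _ h => Subtype.ext h)
  exact e₂.trans e₃.symm

end Integral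

end Cor110Open

end Literature.AnabelianGeometry.AbsoluteAnabelian
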